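import Summits.Parity.GeneralizedHardyLittlewood.Theorems.PrimeLevelFamEdgeMomentsBeyondDiagonalTwoOrderAFE
import Summits.Parity.GeneralizedHardyLittlewood.Theorems.PrimeLevelFamEdgeMomentsBeyondDiagonalDictionaryAtOne
import HarnessLib

/-!
# Route `PrimeLevelFamEdge`, crux K_A `MomentsBeyondDiagonal` (stmt-Parity-20007), line «petersson_layers» v4:
# THE DICTIONARY AT EVERY `Q` — `Q^h(P,Q)(M)` as the explicit two-order spectral sum against the harmonic PAIR average
# (two-order AFE ∘ Hecke (10) ∘ linearity of `Σʰ`, exact; `q` prime, `⌊M⌋ < q`)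

The tree's dictionary `QhPQ_one_eq_tsum_pet` (`…DictionaryAtOne`, p630383) is the `Q = 1` (`i = j = 0`) case. With the
two-order exact AFE of `…TwoOrderAFE` (`derivLambda_mul_eq_tsum_afeTerm_of_mem_newforms0`) the same three steps give, for
EVERY real polynomial `Q`:
* §1 `QhPQ_eq_sum_orders`: `Q^h(P,Q)(M) = Σ_{i,j ≤ deg Q} QᵢQⱼ ℓ^{−(i+j)} Σʰ Λ^{(i)}(f,½)Λ^{(j)}(f,½) M_P(f)²`, `ℓ = log q̂`
  (reality `QhPQ_eq_harmonicSum_sq` + bilinearity);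
* §2 `dictionary_slice₂` / `hasSum_weight_derivLambda_mul_sq`: the `(n₁,n₂)`-slice and the per-form series at orders `(i,j)`;
* §3 `harmonicSum_derivLambda_mul_sq_eq_tsum_pet`: `Σʰ Λ^{(i)}Λ^{(j)} M_P² = Σ'_{(n₁,n₂)} (1+(−1)^{i+j}) q̂ (n₁n₂)^{−1/2} W_{ij}(q̂;n₁,n₂)
  Σ_{m₁,m₂ ≤ M} x_{m₁}x_{m₂} Σ_{d₁∣(m₁,n₁)} Σ_{d₂∣(m₂,n₂)} Σʰ λ_f(m₁n₁/d₁²)λ_f(m₂n₂/d₂²)`;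
* §4 `QhPQ_eq_sum_orders_tsum_pet`: the two combined — deck 21a's `spectralSum q P Q Δ' κ` with `κ = pet q` and the AFE box
  replaced by all of `ℕ × ℕ` (the truncation to the box is the general-`Q` analogue of `…DictionaryAtOneBoxError`, not done here).
This is the general-`Q` input the ∀`Q` forms of `stub_identP` (`TailNearFar rhoP`) and `stub_diag` (`SubDiag`) were waiting on
(lead report g2 §3(b)); the remaining port of `…DictionaryAtOne{Bounds,Truncation,BoxError,OffBoxWeight}` / `…IdentificationAtOne`
to the weights `W_{ij}` (decay `KMV2000.norm_afeW_le`) is NOT done here. Proof only; nothing about Landau–Siegel zeros; K_A NOT proved.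
-/

noncomputable section

open scoped Real
open Complex Finset Polynomial CongruenceSubgroup
open Literature.NumberTheory.EllipticCurves.ModularForms
open Literature.NumberTheory.LFunctions

namespace Summit.Parity.GeneralizedHardyLittlewood.Theorems.MomentsBeyondDiagonal.TwoOrderAFE

open Summit.Parity.GeneralizedHardyLittlewood.Theorems.PrimeLevelFamEdgeIdeaDeltas.PeterssonLayers
  (harmonicSum_congr_newforms harmonicSum_finset_sum harmonicSum_heckeLambda_four_eq_sum_pet QhPQ_eq_harmonicSum_sq)

/-! ## §1. `Q^h(P,Q)` in orders -/

/-- **§1.** For `q` prime: `Q^h(P,Q)(M) = Σ_{i,j ∈ [0, deg Q]} QᵢQⱼ (log q̂)^{−(i+j)} Σʰ_f Λ^{(i)}(f,½)Λ^{(j)}(f,½) M_P(f)²`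
(`KMV2000.Qtilde` squared inside the real square `QhPQ_eq_harmonicSum_sq`, then linearity of `Σʰ`).
[cite: KowalskiMichelVanderKam2000, §6 p. 19 (definition of Q̃ and Q^h(P,Q))] -/
theorem QhPQ_eq_sum_orders {q : ℕ} [NeZero q] (hq : q.Prime) (P Q : ℝ[X]) (M : ℝ) :
    KMV2000.QhPQ q P Q M =
      ∑ i ∈ range (Q.natDegree + 1), ∑ j ∈ range (Q.natDegree + 1),
        (Q.coeff i : ℂ) * (Q.coeff j : ℂ) * (((Real.log (KMV2000.qhat q))⁻¹ : ℝ) : ℂ) ^ (i + j) *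
          GL2Family.harmonicSum q 2
            (fun f ↦ KMV2000.derivLambda q i f * KMV2000.derivLambda q j f * KMV2000.mollifierP q P M f ^ 2) := by
  rw [QhPQ_eq_harmonicSum_sq hq]
  have hsq : ∀ f : CuspForm (Gamma0 q) 2, (KMV2000.Qtilde q Q f * KMV2000.mollifierP q P M f) ^ 2 =
      ∑ i ∈ range (Q.natDegree + 1), ∑ j ∈ range (Q.natDegree + 1),
        (Q.coeff i : ℂ) * (Q.coeff j : ℂ) * (((Real.log (KMV2000.qhat q))⁻¹ : ℝ) : ℂ) ^ (i + j) *
          (KMV2000.derivLambda q i f * KMV2000.derivLambda q j f * KMV2000.mollifierP q P M f ^ 2) := by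
    intro f
    rw [KMV2000.Qtilde, mul_pow, sq, Finset.sum_mul_sum, Finset.sum_mul]
    refine Finset.sum_congr rfl fun i _ ↦ ?_
    rw [Finset.sum_mul]
    refine Finset.sum_congr rfl fun j _ ↦ ?_
    ring
  simp_rw [hsq]
  rw [harmonicSum_finset_sum]
  refine Finset.sum_congr rfl fun i _ ↦ ?_
  rw [harmonicSum_finset_sum]
  refine Finset.sum_congr rfl fun j _ ↦ ?_
  rw [GL2Family.harmonicSum_const_mul]

/-! ## §2. The slice and the per-form series at orders `(i, j)` -/

/-- **§2a. The `(n₁,n₂)`-slice at orders `(i,j)`**: for `q` prime, `⌊M⌋ < q`,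
`Σ_{f ∈ S₂(q)*} ω_f ((1+(−1)^{i+j}) q̂ · afeTerm q f i j n₁ n₂ · M_P(f)²)
 = (1+(−1)^{i+j}) q̂ (n₁n₂)^{−1/2} W_{ij}(q̂;n₁,n₂) Σ_{m₁,m₂ ≤ M} x_{m₁}x_{m₂} Σ_{d₁∣(m₁,n₁)} Σ_{d₂∣(m₂,n₂)} Σʰ λ_f(m₁n₁/d₁²)λ_f(m₂n₂/d₂²)`
(Hecke (10) below the level, `harmonicSum_heckeLambda_four_eq_sum_pet`; both sides vanish on the axes).
[cite: KowalskiMichelVanderKam2000, Lemma 3.1 (10) p. 8 and (22) p. 12] -/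
theorem dictionary_slice₂ {q : ℕ} [NeZero q] (hq : q.Prime) (P : ℝ[X]) {M : ℝ} (hM : ⌊M⌋₊ < q) (i j : ℕ)
    (n : ℕ × ℕ) :
    ∑ f ∈ (finite_newforms0_holds q 2).toFinset, (GL2Family.harmonicWeight f : ℂ) *
        ((1 + (-1 : ℂ) ^ (i + j)) * (KMV2000.qhat q : ℂ) * KMV2000.afeTerm q f i j n.1 n.2 *
          KMV2000.mollifierP q P M f ^ 2) =
      (1 + (-1 : ℂ) ^ (i + j)) * (KMV2000.qhat q : ℂ) *
        (((((n.1 : ℝ) * n.2) ^ (-(1 / 2 : ℝ)) : ℝ) : ℂ) * KMV2000.afeW (KMV2000.qhat q) i j n.1 n.2 *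
        ∑ m₁ ∈ Icc 1 ⌊M⌋₊, ∑ m₂ ∈ Icc 1 ⌊M⌋₊,
          (KMV2000.mollifierCoeff P M m₁ : ℂ) * (KMV2000.mollifierCoeff P M m₂ : ℂ) *
          ∑ d₁ ∈ (Nat.gcd m₁ n.1).divisors, ∑ d₂ ∈ (Nat.gcd m₂ n.2).divisors,
            KowalskiMichel2000.pet q (m₁ * n.1 / d₁ ^ 2) (m₂ * n.2 / d₂ ^ 2)) := by
  have hfin := finite_newforms0_holds q 2
  obtain ⟨c, hc⟩ : ∃ c : ℂ, ((((n.1 : ℝ) * n.2) ^ (-(1 / 2 : ℝ)) : ℝ) : ℂ) *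
      KMV2000.afeW (KMV2000.qhat q) i j n.1 n.2 = c := ⟨_, rfl⟩
  obtain ⟨e, he⟩ : ∃ e : ℂ, (1 + (-1 : ℂ) ^ (i + j)) * (KMV2000.qhat q : ℂ) = e := ⟨_, rfl⟩
  have hterm : ∀ f : CuspForm (Gamma0 q) 2, KMV2000.afeTerm q f i j n.1 n.2 =
      c * (GL2Family.heckeLambda f n.1 * GL2Family.heckeLambda f n.2) := by
    intro f
    rw [KMV2000.afeTerm, ← hc]
    by_cases h0 : n.1 = 0 ∨ n.2 = 0
    · have hz : ((n.1 : ℝ) * n.2) = 0 := by rcases h0 with h | h <;> simp [h]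
      rw [if_pos h0, hz, Real.zero_rpow (by norm_num)]
      simp
    · rw [if_neg h0]
      ring
  have hfold : ∑ f ∈ hfin.toFinset, (GL2Family.harmonicWeight f : ℂ) *
        ((1 + (-1 : ℂ) ^ (i + j)) * (KMV2000.qhat q : ℂ) * KMV2000.afeTerm q f i j n.1 n.2 *
          KMV2000.mollifierP q P M f ^ 2) =
      e * c * GL2Family.harmonicSum q 2 (fun f ↦
        GL2Family.heckeLambda f n.1 * GL2Family.heckeLambda f n.2 * KMV2000.mollifierP q P M f ^ 2) := by
    unfold GL2Family.harmonicSum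
    rw [finsum_mem_eq_finite_toFinset_sum _ hfin, Finset.mul_sum]
    refine Finset.sum_congr rfl fun f _ ↦ ?_
    rw [hterm f, he]
    ring
  have hsq : ∀ f : CuspForm (Gamma0 q) 2,
      GL2Family.heckeLambda f n.1 * GL2Family.heckeLambda f n.2 * KMV2000.mollifierP q P M f ^ 2 =
        ∑ m₁ ∈ Icc 1 ⌊M⌋₊, ∑ m₂ ∈ Icc 1 ⌊M⌋₊,
          (KMV2000.mollifierCoeff P M m₁ : ℂ) * (KMV2000.mollifierCoeff P M m₂ : ℂ) *
            (GL2Family.heckeLambda f n.1 * GL2Family.heckeLambda f n.2 *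
              (GL2Family.heckeLambda f m₁ * GL2Family.heckeLambda f m₂)) := by
    intro f
    rw [KMV2000.mollifierP_eq_sum_mollifierCoeff, sq, Finset.sum_mul_sum, Finset.mul_sum]
    refine Finset.sum_congr rfl fun m₁ _ ↦ ?_
    rw [Finset.mul_sum]
    refine Finset.sum_congr rfl fun m₂ _ ↦ ?_
    ring
  by_cases h0 : n.1 = 0 ∨ n.2 = 0
  · have hr : (((n.1 : ℝ) * n.2) ^ (-(1 / 2 : ℝ)) : ℝ) = 0 := by
      have hz : ((n.1 : ℝ) * n.2) = 0 := by
        rcases h0 with h | h <;> simp [h]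
      rw [hz, Real.zero_rpow (by norm_num)]
    have hc0 : c = 0 := by rw [← hc, hr]; simp
    rw [hfold, hc0, hr]
    simp
  · rw [not_or] at h0
    have h₁ : 1 ≤ n.1 := Nat.one_le_iff_ne_zero.mpr h0.1
    have h₂ : 1 ≤ n.2 := Nat.one_le_iff_ne_zero.mpr h0.2
    have hH : GL2Family.harmonicSum q 2 (fun f ↦
        GL2Family.heckeLambda f n.1 * GL2Family.heckeLambda f n.2 * KMV2000.mollifierP q P M f ^ 2) =
        ∑ m₁ ∈ Icc 1 ⌊M⌋₊, ∑ m₂ ∈ Icc 1 ⌊M⌋₊,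
          (KMV2000.mollifierCoeff P M m₁ : ℂ) * (KMV2000.mollifierCoeff P M m₂ : ℂ) *
          ∑ d₁ ∈ (Nat.gcd m₁ n.1).divisors, ∑ d₂ ∈ (Nat.gcd m₂ n.2).divisors,
            KowalskiMichel2000.pet q (m₁ * n.1 / d₁ ^ 2) (m₂ * n.2 / d₂ ^ 2) := by
      simp_rw [hsq]
      rw [harmonicSum_finset_sum]
      refine Finset.sum_congr rfl fun m₁ hm₁ ↦ ?_
      rw [harmonicSum_finset_sum]
      refine Finset.sum_congr rfl fun m₂ hm₂ ↦ ?_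
      rw [Finset.mem_Icc] at hm₁ hm₂
      rw [GL2Family.harmonicSum_const_mul,
        harmonicSum_heckeLambda_four_eq_sum_pet hq hm₁.1 (lt_of_le_of_lt hm₁.2 hM) hm₂.1
          (lt_of_le_of_lt hm₂.2 hM) h₁ h₂]
    rw [hfold, hH, ← hc, ← he]
    ring

/-- **§2b. Per form**: `ω_f Λ^{(i)}Λ^{(j)} M_P(f)² = Σ'_n ω_f ((1+(−1)^{i+j}) q̂ · afeTerm q f i j n · M_P(f)²)`, absolutely convergent
(the two-order exact AFE `derivLambda_mul_eq_tsum_afeTerm_of_mem_newforms0`, times the constants).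
[cite: KowalskiMichelVanderKam2000, (21)–(22) p. 12] -/
theorem hasSum_weight_derivLambda_mul_sq {q : ℕ} [NeZero q] (P : ℝ[X]) (M : ℝ)
    {f : CuspForm (Gamma0 q) 2} (hf : f ∈ newforms0 q 2) (i j : ℕ) :
    Summable (fun n : ℕ × ℕ ↦ (GL2Family.harmonicWeight f : ℂ) *
        ((1 + (-1 : ℂ) ^ (i + j)) * (KMV2000.qhat q : ℂ) * KMV2000.afeTerm q f i j n.1 n.2 *
          KMV2000.mollifierP q P M f ^ 2)) ∧
      (GL2Family.harmonicWeight f : ℂ) *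
          (KMV2000.derivLambda q i f * KMV2000.derivLambda q j f * KMV2000.mollifierP q P M f ^ 2) =
        ∑' n : ℕ × ℕ, (GL2Family.harmonicWeight f : ℂ) *
          ((1 + (-1 : ℂ) ^ (i + j)) * (KMV2000.qhat q : ℂ) * KMV2000.afeTerm q f i j n.1 n.2 *
            KMV2000.mollifierP q P M f ^ 2) := by
  obtain ⟨hsum, heq⟩ := derivLambda_mul_eq_tsum_afeTerm_of_mem_newforms0 f hf i j
  have hs : Summable (fun n : ℕ × ℕ ↦ KMV2000.afeTerm q f i j n.1 n.2) := hsum.of_norm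
  refine ⟨((hs.mul_left ((1 + (-1 : ℂ) ^ (i + j)) * (KMV2000.qhat q : ℂ))).mul_right
    (KMV2000.mollifierP q P M f ^ 2)).mul_left _, ?_⟩
  rw [heq, ← tsum_mul_left, ← tsum_mul_right, ← tsum_mul_left]

/-! ## §3. The dictionary at orders `(i, j)` -/

/-- **§3. THE DICTIONARY AT ORDERS `(i,j)` (exact).** For `q` prime and `⌊M⌋ < q`:
`Σʰ_f Λ^{(i)}(f,½)Λ^{(j)}(f,½) M_P(f)² = Σ'_{(n₁,n₂)} (1+(−1)^{i+j}) q̂ (n₁n₂)^{−1/2} W_{ij}(q̂;n₁,n₂) Σ_{m₁,m₂ ≤ M} x_{m₁}x_{m₂}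
 Σ_{d₁∣(m₁,n₁)} Σ_{d₂∣(m₂,n₂)} Σʰ λ_f(m₁n₁/d₁²)λ_f(m₂n₂/d₂²)`. [cite: KowalskiMichelVanderKam2000, (21)–(22) p. 12 with Lemma 3.1 (10)] -/
theorem harmonicSum_derivLambda_mul_sq_eq_tsum_pet {q : ℕ} [NeZero q] (hq : q.Prime) (P : ℝ[X]) {M : ℝ}
    (hM : ⌊M⌋₊ < q) (i j : ℕ) :
    GL2Family.harmonicSum q 2
        (fun f ↦ KMV2000.derivLambda q i f * KMV2000.derivLambda q j f * KMV2000.mollifierP q P M f ^ 2) =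
      ∑' n : ℕ × ℕ, (1 + (-1 : ℂ) ^ (i + j)) * (KMV2000.qhat q : ℂ) *
        (((((n.1 : ℝ) * n.2) ^ (-(1 / 2 : ℝ)) : ℝ) : ℂ) * KMV2000.afeW (KMV2000.qhat q) i j n.1 n.2 *
        ∑ m₁ ∈ Icc 1 ⌊M⌋₊, ∑ m₂ ∈ Icc 1 ⌊M⌋₊,
          (KMV2000.mollifierCoeff P M m₁ : ℂ) * (KMV2000.mollifierCoeff P M m₂ : ℂ) *
          ∑ d₁ ∈ (Nat.gcd m₁ n.1).divisors, ∑ d₂ ∈ (Nat.gcd m₂ n.2).divisors,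
            KowalskiMichel2000.pet q (m₁ * n.1 / d₁ ^ 2) (m₂ * n.2 / d₂ ^ 2)) := by
  have hfin := finite_newforms0_holds q 2
  unfold GL2Family.harmonicSum
  rw [finsum_mem_eq_finite_toFinset_sum _ hfin]
  have hf_each : ∀ f ∈ hfin.toFinset, (GL2Family.harmonicWeight f : ℂ) *
        (KMV2000.derivLambda q i f * KMV2000.derivLambda q j f * KMV2000.mollifierP q P M f ^ 2) =
        ∑' n : ℕ × ℕ, (GL2Family.harmonicWeight f : ℂ) *
          ((1 + (-1 : ℂ) ^ (i + j)) * (KMV2000.qhat q : ℂ) * KMV2000.afeTerm q f i j n.1 n.2 *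
            KMV2000.mollifierP q P M f ^ 2) :=
    fun f hf ↦ (hasSum_weight_derivLambda_mul_sq P M ((Set.Finite.mem_toFinset hfin).mp hf) i j).2
  have hg_sum : ∀ f ∈ hfin.toFinset, Summable (fun n : ℕ × ℕ ↦ (GL2Family.harmonicWeight f : ℂ) *
      ((1 + (-1 : ℂ) ^ (i + j)) * (KMV2000.qhat q : ℂ) * KMV2000.afeTerm q f i j n.1 n.2 *
        KMV2000.mollifierP q P M f ^ 2)) :=
    fun f hf ↦ (hasSum_weight_derivLambda_mul_sq P M ((Set.Finite.mem_toFinset hfin).mp hf) i j).1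
  rw [Finset.sum_congr rfl hf_each, ← Summable.tsum_finsetSum hg_sum]
  exact tsum_congr fun n ↦ dictionary_slice₂ hq P hM i j n

/-- Absolute convergence of the `(i,j)` dictionary series (a finite sum of convergent series). -/
theorem summable_dictionaryTerm₂ {q : ℕ} [NeZero q] (hq : q.Prime) (P : ℝ[X]) {M : ℝ} (hM : ⌊M⌋₊ < q)
    (i j : ℕ) :
    Summable (fun n : ℕ × ℕ ↦ (1 + (-1 : ℂ) ^ (i + j)) * (KMV2000.qhat q : ℂ) *
        (((((n.1 : ℝ) * n.2) ^ (-(1 / 2 : ℝ)) : ℝ) : ℂ) * KMV2000.afeW (KMV2000.qhat q) i j n.1 n.2 *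
        ∑ m₁ ∈ Icc 1 ⌊M⌋₊, ∑ m₂ ∈ Icc 1 ⌊M⌋₊,
          (KMV2000.mollifierCoeff P M m₁ : ℂ) * (KMV2000.mollifierCoeff P M m₂ : ℂ) *
          ∑ d₁ ∈ (Nat.gcd m₁ n.1).divisors, ∑ d₂ ∈ (Nat.gcd m₂ n.2).divisors,
            KowalskiMichel2000.pet q (m₁ * n.1 / d₁ ^ 2) (m₂ * n.2 / d₂ ^ 2))) := by
  have hfin := finite_newforms0_holds q 2
  have hg_sum : ∀ f ∈ hfin.toFinset, Summable (fun n : ℕ × ℕ ↦ (GL2Family.harmonicWeight f : ℂ) *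
      ((1 + (-1 : ℂ) ^ (i + j)) * (KMV2000.qhat q : ℂ) * KMV2000.afeTerm q f i j n.1 n.2 *
        KMV2000.mollifierP q P M f ^ 2)) :=
    fun f hf ↦ (hasSum_weight_derivLambda_mul_sq P M ((Set.Finite.mem_toFinset hfin).mp hf) i j).1
  exact (summable_sum hg_sum).congr fun n ↦ dictionary_slice₂ hq P hM i j n

/-! ## §4. The dictionary at every `Q` -/

/-- **§4. THE DICTIONARY AT EVERY `Q` (exact; two-order AFE ∘ Hecke ∘ `Σʰ`-linearity in the kernel).** For `q` prime and
`⌊M⌋ < q`: `Q^h(P,Q)(M) = Σ_{i,j ≤ deg Q} QᵢQⱼ ℓ^{−(i+j)} Σ'_{(n₁,n₂)} (1+(−1)^{i+j}) q̂ (n₁n₂)^{−1/2} W_{ij}(q̂;n₁,n₂)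
Σ_{m₁,m₂ ≤ M} x_{m₁}x_{m₂} Σ_{d₁∣(m₁,n₁)} Σ_{d₂∣(m₂,n₂)} Σʰ λ_f(m₁n₁/d₁²)λ_f(m₂n₂/d₂²)` — deck 21a's `spectralSum q P Q Δ' κ` at
`κ = pet q`, before truncation to the AFE box. [cite: KowalskiMichelVanderKam2000, §5 (21)–(22) p. 12–13, §6 p. 19] -/
theorem QhPQ_eq_sum_orders_tsum_pet {q : ℕ} [NeZero q] (hq : q.Prime) (P Q : ℝ[X]) {M : ℝ} (hM : ⌊M⌋₊ < q) :
    KMV2000.QhPQ q P Q M =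
      ∑ i ∈ range (Q.natDegree + 1), ∑ j ∈ range (Q.natDegree + 1),
        (Q.coeff i : ℂ) * (Q.coeff j : ℂ) * (((Real.log (KMV2000.qhat q))⁻¹ : ℝ) : ℂ) ^ (i + j) *
        ∑' n : ℕ × ℕ, (1 + (-1 : ℂ) ^ (i + j)) * (KMV2000.qhat q : ℂ) *
          (((((n.1 : ℝ) * n.2) ^ (-(1 / 2 : ℝ)) : ℝ) : ℂ) * KMV2000.afeW (KMV2000.qhat q) i j n.1 n.2 *
          ∑ m₁ ∈ Icc 1 ⌊M⌋₊, ∑ m₂ ∈ Icc 1 ⌊M⌋₊,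
            (KMV2000.mollifierCoeff P M m₁ : ℂ) * (KMV2000.mollifierCoeff P M m₂ : ℂ) *
            ∑ d₁ ∈ (Nat.gcd m₁ n.1).divisors, ∑ d₂ ∈ (Nat.gcd m₂ n.2).divisors,
              KowalskiMichel2000.pet q (m₁ * n.1 / d₁ ^ 2) (m₂ * n.2 / d₂ ^ 2)) := by
  rw [QhPQ_eq_sum_orders hq]
  refine Finset.sum_congr rfl fun i _ ↦ Finset.sum_congr rfl fun j _ ↦ ?_
  rw [harmonicSum_derivLambda_mul_sq_eq_tsum_pet hq P hM i j]

end Summit.Parity.GeneralizedHardyLittlewood.Theorems.MomentsBeyondDiagonal.TwoOrderAFE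

end
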